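import Summits.QuantumFields.YangMills.Theorems.FluctuationComparisonRegPrIntLS2BetaIterAxialGaugeSup
import Summits.QuantumFields.YangMills.Theorems.FluctuationComparisonRegPrIntLS2BetaFlatTubeWLOG
import HarnessLib

/-!
# hFlat MAY BE PROVED INSIDE THE ITERATED SUP TUBE: «WLOG every bond of EVERY LEVEL `M^j U` (`j ≤ K − J`) is within `δ` of `1`» — the multi-level edition of ✓`…S2BetaFlatTubeWLOG`
# (crux `FluctuationComparisonRegPrIntL`, stmt-QuantumFields-20520; registry v11.4 `Cruxes/FluctuationComparisonRegPrIntL/Lines/semiclassical_s2beta.lean` 3732b7df FROZEN, untouched)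

Cell `ym3-torus` (YM ladder rung R3 = continuum `SU(2)` Yang–Mills on the three-torus — a RUNG: NOT d = 4, NOT infinite volume, NOT a mass gap, NOT Clay).
Width seat `ym3-torus-px10` (gen 21); `--kind proof --supports stmt-QuantumFields-20520 --as helper`, count-neutral, DEFINITION-FREE (0 `def`, 0 `instance`,
0 `notation`, 0 `sorry`, default heartbeats).

WHY.  px12 g22's ✓p813841 `…S2BetaFlatTubeWLOG` reduces the letter `hFlat` (third hypothesis of ✓`…S2BetaGapOrbitOfStrata.uniformFibreGapOrbit_of_strata_of_flat`) to its
edition for good histories over the flat datum ALL OF WHOSE FINEST BONDS are `δ`-close to `1` (regauge by the residual `w` of ✓`closePair_holds` with `U′ := 1`; the orbit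
functional is blind to residual regauging).  The telescoped road (px8 g21 UV3-NODE §57.7∕§57.8 (B)) interpolates LEVEL-`j` objects for every `j`, so it wants the same door with
the smallness at EVERY level: this file supplies it from this seat's ITERATED RESIDUAL AXIAL GAUGE SUP LEMMA (✓p814387 `exists_gamma_iterAxialGauge_le_T3`).
* §1 ★★ `iterFlatSupTube`: for `L`, `b₀, p₀ > 0`, `δ > 0` there is `γ₁ > 0` such that for `γ ≤ γ₁` every good history `U` over the flat datum admits a RESIDUAL `u`
  (`D_{J,K}(u • U″) = D_{J,K}U″` for ALL `U″`, i.e. `u` lies in print's group (4)) such that `u • U` is AGAIN a good history over the flat datum and EVERY bond of EVERY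
  averaged level `M^j(u • U)`, `j ≤ K − J`, is within `δ` of `1` — volume- and depth-free (`u = g₀` of the iterated comb-axial gauge; covariance `M^j(g₀ • U) = g_j • M^jU`).
* §2 ★★★ `hFlat_of_inIterTube`: if the flat growth letter holds for the good histories over the flat datum whose every level is bondwise `δ`-small (a `δ > 0` chosen
  first, per `L`), then it holds VERBATIM — ✓p813841's §2 `iInf_orbit_le_iInf_orbit_regauge` + the invariance rows of ✓`…S2BetaResidualGauge`, with `w := u⁻¹`.

HONEST: quantifier∕invariance bookkeeping over landed letters; the in-tube letter is NOT proved; nothing of Bałaban's analysis; `hFlat`, TUBE-REG∘, GAP♯∘, EXW∘, S2β, crux 20520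
NOT proved; no registered stub closed; rung R3 = SU(2) YM₃ on T³ — NOT d = 4, NOT infinite volume, NOT a mass gap, NOT Clay; the Yang–Mills mass gap is NOT proved.  Sorry-free,
axioms standard.

References: T. Bałaban, CMP **99** (1985) 75–102 [Balaban1985RegularSpaces] ((1.19) p.79, Lemma 1 (1.24)–(1.26) pp.79–80, (1.65) p.87); CMP **102** (1985) 277–309
[Balaban1985Variational] ((4) p.278); CMP **96** (1984) 223–250 [Balaban1984PropagatorsII] ((1.33)).
-/

set_option autoImplicit false

noncomputable section

namespace Summit.QuantumFields.YangMills.Theorems.FluctuationComparisonRegPrIntLS2BetaIterFlatTubeWLOG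

open Literature.MathematicalPhysics.QuantumFieldTheory.Balaban1983to89
open T4Continuum T3ContinuumYM3Torus T3UnitScaleTilt T3TiltDescent T3LevelShift BlockAveraging
open T3UnitLawDensityEML (ℰp)
open T3ConstrainedMinimiser (fibre)
open T3PrintedRegularMinimiser (minActionRegPr)
open Summit.QuantumFields.YangMills.Theorems.FluctuationComparisonRegPrIntLS2BetaResidualGauge
  (residual_inv gaugeAct_mem_fibre_iff_of_residual gaugeAct_mem_histGood_iff wilsonAction4_gaugeAct)
open Summit.QuantumFields.YangMills.Theorems.FluctuationComparisonRegPrIntLS2BetaFlatTubeWLOG (iInf_orbit_le_iInf_orbit_regauge)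
open Summit.QuantumFields.YangMills.Theorems.FluctuationComparisonRegPrIntLS2BetaIterAxialGaugeSup (iter_gaugeAct_of_emb exists_gamma_iterAxialGauge_le_T3)

open scoped Matrix.Norms.L2Operator

/-! ## §1 The iterated flat sup tube -/

/-- ★★ **THE ITERATED FLAT SUP TUBE**: for `L`, `b₀, p₀ > 0` and every `δ > 0` there is `γ₁ > 0` such that for `γ ≤ γ₁` every good history `U` over the flat datum admits a RESIDUAL
`u` (print's group (4): `D_{J,K}(u • U″) = D_{J,K} U″` for every `U″`) with `u • U` again a good history over the flat datum and EVERY bond of EVERY averaged level `M^j(u • U)`,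
`j ≤ K − J`, within `δ` of `1` — depth- and volume-uniformly (`u` = the bottom of the iterated comb-axial gauge of ✓`exists_gamma_iterAxialGauge_le_T3`; for `L ≤ 1` there is no
family and the statement is vacuous). [cite: Balaban1985RegularSpaces, (1.19) p.79 and (1.65) p.87; Balaban1985Variational, (4) p.278] -/
theorem iterFlatSupTube (L : ℕ) (b₀ p₀ : ℝ) (hb : 0 < b₀) (hp : 0 < p₀) (δ : ℝ) (hδ : 0 < δ) :
    ∃ γ₁ : ℝ, 0 < γ₁ ∧ ∀ (F : T3Family) (γ : ℝ), F.L = L → 0 < γ → γ ≤ γ₁ →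
      ∀ (J K : ℕ) (hJK : J ≤ K),
        ∀ U ∈ fibre F ℰp J K hJK (1 : GaugeField (F.P J) 0 (Matrix.specialUnitaryGroup (Fin 2) ℂ)), U ∈ histGood F ℰp (θBal F.L γ b₀ p₀) K J →
          ∃ u : Site (F.P K) 0 → Matrix.specialUnitaryGroup (Fin 2) ℂ,
            (∀ U'' : GaugeField (F.P K) 0 (Matrix.specialUnitaryGroup (Fin 2) ℂ),
                descendTo F ℰp J K hJK (GaugeField.gaugeAct u U'') = descendTo F ℰp J K hJK U'') ∧
              GaugeField.gaugeAct u U ∈ fibre F ℰp J K hJK (1 : GaugeField (F.P J) 0 (Matrix.specialUnitaryGroup (Fin 2) ℂ)) ∧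
              GaugeField.gaugeAct u U ∈ histGood F ℰp (θBal F.L γ b₀ p₀) K J ∧
              ∀ j, j ≤ K - J → ∀ b : PBond (F.P K) j,
                dist1 (Averaging.iter (fun k => blockAvg (P := F.P K) (j := k) ℰp) j (GaugeField.gaugeAct u U) b) ≤ δ := by
  by_cases hL : 1 < L
  · obtain ⟨γ₁, hγ₁, h⟩ := exists_gamma_iterAxialGauge_le_T3 L hL b₀ p₀ hb hp δ hδ
    refine ⟨γ₁, hγ₁, fun F γ hFL hγ hγle J K hJK U hU hUg => ?_⟩
    obtain ⟨g, hg1, -, hg3, -, hg5, hg6⟩ := h F γ hFL hγ hγle J K hJK U hU hUg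
    have hm : K - J ≤ (F.P K).m + (F.P K).K := by show K - J ≤ F.m + K; omega
    have htop1 : g (K - J) = 1 := funext fun y => hg1 (K - J) le_rfl y
    -- `g 0` is residual for EVERY field: covariance along the tower + `g_{K−J} ≡ 1`
    have hres : ∀ U'' : GaugeField (F.P K) 0 (Matrix.specialUnitaryGroup (Fin 2) ℂ),
        descendTo F ℰp J K hJK (GaugeField.gaugeAct (g 0) U'') = descendTo F ℰp J K hJK U'' := by
      intro U''
      show fieldShift _ (Averaging.iter (fun k => blockAvg (P := F.P K) (j := k) ℰp) (K - J) (GaugeField.gaugeAct (g 0) U'')) =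
        fieldShift _ (Averaging.iter (fun k => blockAvg (P := F.P K) (j := k) ℰp) (K - J) U'')
      rw [iter_gaugeAct_of_emb (fun k => blockAvg (P := F.P K) (j := k) ℰp) hm g hg3 U'' (K - J) le_rfl, htop1]
      congr 1
      exact B12RTGaugeInvariance254.gaugeAct_one' _
    refine ⟨g 0, hres, (gaugeAct_mem_fibre_iff_of_residual F hJK hres U 1).2 hU, (gaugeAct_mem_histGood_iff F (g 0) _ _ U).2 hUg, fun j hj b => ?_⟩
    rw [hg5 j hj]
    exact hg6 j hj b
  · refine ⟨1, one_pos, fun F γ hFL _ _ J K hJK U _ _ => ?_⟩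
    exact absurd ((F.P K).hL.2) (by rw [show (F.P K).L = L from hFL]; exact hL)

/-! ## §2 The door: hFlat from its edition inside the iterated tube -/

variable (F : T3Family)

/-- ★★★ **hFlat FROM hFlat-IN-THE-ITERATED-TUBE**: if the flat growth letter holds for the good histories over the flat datum EVERY LEVEL OF WHICH is bondwise within `δ` of `1`
(`δ > 0` chosen first, per `L`), then it holds VERBATIM (the third hypothesis of ✓`…S2BetaGapOrbitOfStrata.uniformFibreGapOrbit_of_strata_of_flat`): regauge by the residual `u` of
`iterFlatSupTube`; the fibre of `1`, `histGood`, the action and the regular minimum are invariant, and the orbit functional does not increase (✓`iInf_orbit_le_iInf_orbit_regauge` with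
`w := u⁻¹`). [cite: Balaban1985RegularSpaces, (1.65) p.87; Balaban1984PropagatorsII, (1.33)] -/
theorem hFlat_of_inIterTube
    (hTube : ∀ (L : ℕ), ∃ δ : ℝ, 0 < δ ∧ ∃ pS : ℝ, ∀ (b₀ p₀ : ℝ), 0 < b₀ → pS ≤ p₀ → 0 < p₀ → ∃ ε₁ : ℝ, 0 < ε₁ ∧ ∀ (ε₀ : ℝ), 0 < ε₀ → ε₀ ≤ ε₁ →
      ∃ γ₁ : ℝ, 0 < γ₁ ∧ ∃ μ : ℝ, 0 < μ ∧ ∀ (F : T3Family) (γ : ℝ), F.L = L → 0 < γ → γ ≤ γ₁ →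
        ∀ (J K : ℕ) (hlt : J < K),
          ∀ U ∈ fibre F ℰp J K hlt.le (1 : GaugeField (F.P J) 0 (Matrix.specialUnitaryGroup (Fin 2) ℂ)), U ∈ histGood F ℰp (θBal F.L γ b₀ p₀) K J →
            (∀ j, j ≤ K - J → ∀ b : PBond (F.P K) j, dist1 (Averaging.iter (fun k => blockAvg (P := F.P K) (j := k) ℰp) j U b) ≤ δ) →
            μ * ((F.L : ℝ)⁻¹) ^ (2 * (K - J)) *
                (⨅ w : {w : Site (F.P K) 0 → Matrix.specialUnitaryGroup (Fin 2) ℂ |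
                    ∀ U : GaugeField (F.P K) 0 (Matrix.specialUnitaryGroup (Fin 2) ℂ),
                      descendTo F ℰp J K hlt.le (GaugeField.gaugeAct w U) = descendTo F ℰp J K hlt.le U},
                  ∑ ℓ : PBond (F.P K) 0,
                    dist1 (U ℓ * ((GaugeField.gaugeAct (w : Site (F.P K) 0 → Matrix.specialUnitaryGroup (Fin 2) ℂ) (1 : GaugeField (F.P K) 0 (Matrix.specialUnitaryGroup (Fin 2) ℂ))) ℓ)⁻¹) ^ 2)
              ≤ wilsonAction4 U - minActionRegPr F J K hlt.le ε₀ (1 : GaugeField (F.P J) 0 (Matrix.specialUnitaryGroup (Fin 2) ℂ))) :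
    ∀ (L : ℕ), ∃ pS : ℝ, ∀ (b₀ p₀ : ℝ), 0 < b₀ → pS ≤ p₀ → 0 < p₀ → ∃ ε₁ : ℝ, 0 < ε₁ ∧ ∀ (ε₀ : ℝ), 0 < ε₀ → ε₀ ≤ ε₁ →
    ∃ γ₁ : ℝ, 0 < γ₁ ∧ ∃ μ : ℝ, 0 < μ ∧ ∀ (F : T3Family) (γ : ℝ), F.L = L → 0 < γ → γ ≤ γ₁ →
      ∀ (J K : ℕ) (hlt : J < K),
        ∀ U ∈ fibre F ℰp J K hlt.le (1 : GaugeField (F.P J) 0 (Matrix.specialUnitaryGroup (Fin 2) ℂ)), U ∈ histGood F ℰp (θBal F.L γ b₀ p₀) K J →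
          μ * ((F.L : ℝ)⁻¹) ^ (2 * (K - J)) *
              (⨅ w : {w : Site (F.P K) 0 → Matrix.specialUnitaryGroup (Fin 2) ℂ |
                  ∀ U : GaugeField (F.P K) 0 (Matrix.specialUnitaryGroup (Fin 2) ℂ),
                    descendTo F ℰp J K hlt.le (GaugeField.gaugeAct w U) = descendTo F ℰp J K hlt.le U},
                ∑ ℓ : PBond (F.P K) 0,
                  dist1 (U ℓ * ((GaugeField.gaugeAct (w : Site (F.P K) 0 → Matrix.specialUnitaryGroup (Fin 2) ℂ) (1 : GaugeField (F.P K) 0 (Matrix.specialUnitaryGroup (Fin 2) ℂ))) ℓ)⁻¹) ^ 2)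
            ≤ wilsonAction4 U - minActionRegPr F J K hlt.le ε₀ (1 : GaugeField (F.P J) 0 (Matrix.specialUnitaryGroup (Fin 2) ℂ)) := by
  intro L
  obtain ⟨δ, hδ, pS, hpS⟩ := hTube L
  refine ⟨pS, fun b₀ p₀ hb hpS' hp => ?_⟩
  obtain ⟨ε₁, hε₁, hε⟩ := hpS b₀ p₀ hb hpS' hp
  refine ⟨ε₁, hε₁, fun ε₀ hε₀ hε₀1 => ?_⟩
  obtain ⟨γ₁, hγ₁, μ, hμ, hmain⟩ := hε ε₀ hε₀ hε₀1
  obtain ⟨γ₂, hγ₂, htube⟩ := iterFlatSupTube L b₀ p₀ hb hp δ hδ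
  refine ⟨min γ₁ γ₂, lt_min hγ₁ hγ₂, μ, hμ, fun F γ hFL hγ hγle J K hlt U hU hUg => ?_⟩
  obtain ⟨u, hu, hU₁, hU₁g, hU₁δ⟩ := htube F γ hFL hγ (hγle.trans (min_le_right _ _)) J K hlt.le U hU hUg
  have h := hmain F γ hFL hγ (hγle.trans (min_le_left _ _)) J K hlt (GaugeField.gaugeAct u U) hU₁ hU₁g hU₁δ
  rw [wilsonAction4_gaugeAct] at h
  refine le_trans ?_ h
  have hL0 : (0 : ℝ) ≤ ((F.L : ℝ)⁻¹) ^ (2 * (K - J)) := by positivity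
  refine mul_le_mul_of_nonneg_left ?_ (mul_nonneg hμ.le hL0)
  have hw := residual_inv F hlt.le hu
  have key := iInf_orbit_le_iInf_orbit_regauge F hlt.le U hw
  rw [inv_inv] at key
  exact key

end Summit.QuantumFields.YangMills.Theorems.FluctuationComparisonRegPrIntLS2BetaIterFlatTubeWLOG

end
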